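import Literature.Computability.AlgebraicComplexity.CombinatorialDegeneration
import Literature.Computability.AlgebraicComplexity.TruncatedPolynomialBorderRank
import Literature.Barriers.MatrixMultiplication.IrreversibilityBarrier
import HarnessLib

/-!
# Route `SaturationLadder` — curvilinear domination (split form): `Str(K[t]/(t^{q+2})) ⊵ L_q`, the split big
# Coppersmith–Winograd tensor, for EVERY `q`, over every commutative semiring
# (decomp-mm lens 1 «grading / quantitative ladder», gen 41; support kernel beneath crux `SubexpSaturation`,
# stmt-MatrixMultiplication-25909; part 1 of 3 of the answer to census question CURVILINEAR (E3′) of memo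
# `decomp-mm-lens-1/gen40/NODE-SaturationLadder-g40.md` §3b — part 2 `SaturationLadderSplitCwGram` (the change of
# basis), part 3 `SaturationLadderCurvilinearDominationCw` (`Str(ℂ[t]/(t^{q+2})) ⊵ CW_q` and the consequences))

PROVED, 0 sorry; no definitions, no instances, no named facts.  Tensors are bare functions
`Fin n → Fin n → Fin n → K` as in `Literature.Computability.AlgebraicComplexity`:
`truncPolyMulTensor K m z x y = [x + y = z]` is the structure tensor `P_m` of `K[t]/(t^m)` (BCS Ex. (15.20); border
rank `m`, in tree `algBorderRank_truncPolyMulTensor`), `PolyDegeneratesTo` is BCS (15.19), `IsCombDegeneration` /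
`BCS1997_prop_15_30` are BCS Def. (15.29) / Prop. (15.30).

THE SPLIT BIG COPPERSMITH–WINOGRAD TENSOR.  `L_q : Fin (q+2) → Fin (q+2) → Fin (q+2) → K`,
`L_q z x y = [x + y = z ∧ (x = 0 ∨ y = 0 ∨ z = q+1)]` (written inline below, no definition): the structure tensor
of the graded local algebra `K·1 ⊕ (K x_1 ⊕ ⋯ ⊕ K x_q) ⊕ K·s`, `x_i x_j = [i + j = q+1]·s`, `x_i s = s² = 0` — the
big Coppersmith–Winograd algebra `k[x_1,…,x_q]/(x_i x_j (i ≠ j), x_i² − x_j², x_i³)` (Bläser–Lysikov §3.4) with its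
quadratic form taken SPLIT, `Σ_i x_i x_{q+1−i}`, instead of diagonal.  Support: `(0;0,0)`, `(j;0,j)`, `(j;j,0)`
(`1 ≤ j ≤ q+1`), `(q+1; i, q+1−i)` (`1 ≤ i ≤ q`): `3q + 3` points, all inside the support `{x + y = z}` of `P_{q+2}`.
Over a field with `i² = −1` and `2 ≠ 0` (e.g. `ℂ`) `L_q ≅ CW_q` (part 2–3); over `ℚ`/`ℝ` not for odd `q`.

THE THEOREMS.
* `isCombDegeneration_truncPoly_splitCw` — the weights `a(z) = w(z)`, `b(x) = −w(x)`, `c(y) = −w(y)` with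
  `w(i) = min (i−1) (q−1)` (`w(0) = w(1) = 0`, `w(i) = i−1` for `1 ≤ i ≤ q`, `w(q+1) = q−1`) sum to `0` exactly on
  the support of `L_q` and to `1` on the rest `{x + y = z, x ≥ 1, y ≥ 1, z ≤ q}` of the support of `P_{q+2}`:
  a combinatorial degeneration in the sense of BCS Def. (15.29)(2) (linear arithmetic, `omega`);
* `truncPolyMulTensor_polyDegeneratesTo_splitCw` — hence `P_{q+2} ⊵ L_q` (BCS Prop. (15.30) with the finest
  blocking; monomially `t^z ↦ ε^{w(z)} t^z` on the output, `ε^{−w}` on the inputs), over every commutative semiring;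
* `truncPolyMulTensor_kroneckerPow_polyDegeneratesTo_splitCw` — the same for Kronecker powers;
* `asymptoticRank_splitCw_le_truncPolyMulTensor` — `R̃(L_q) ≤ R̃(P_{q+2})` over every field.

WHY (memo `decomp-mm-lens-1/gen41/NODE-SaturationLadder-g41.md` §1–2).  The lineage's unique-usage map (gens 37–40)
put every graded-algebra base of a far-edge certificate for item 25909 below `CW_q`; this file and its two sequels
put `CW_q` itself below the single curvilinear tensor `P_{q+2}` of the same format and border rank, so that the
single-scale additive laser class (floor `c⋆ = 1.0645958`, proved rate `c₂ = 1.0650531`) is a subclass of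
«degeneration methods applied to `P_m`», one tensor per format — the enlargement on which the catalogued
irreversibility barrier recedes to `2` (CVZ 2021 §1.4: the `t_n`-barrier decreases to `2`, the `CW_q`-barrier
increases to `3`).  The `(M;M,M)` block `{x + y = z; x, y ≥ 1, z ≤ q}` discarded here is exactly the extra support a
`P_m`-design may use.  A statement about base tensors, not about `ω`.
[cite: BurgisserClausenShokrollahi1997, Def. (15.29), Prop. (15.30), Ex. (15.20); BlaserLysikov2016, §3.4;
ChristandlVranaZuiddam2021, Thm. 22, §1.4]
-/

set_option linter.dupNamespace false

noncomputable section

open scoped BigOperators Polynomial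

namespace Summit.MatrixMultiplication.MatrixMultiplication.Theorems.SaturationLadderCurvilinearDomination

open Literature.Computability.AlgebraicComplexity Literature.Barriers.MatrixMultiplication

universe u

/-! ## 1. The combinatorial degeneration of the support of `Str(K[t]/(t^{q+2}))` (BCS Def. (15.29)) -/

section CombDeg

/-- **The weights.** On the support `Φ = {(z,x,y) : x + y = z}` of the structure tensor of `K[t]/(t^{q+2})`
(finest blocking, coordinates `(output, input, input)`) put `a(z) = w(z)`, `b(x) = −w(x)`, `c(y) = −w(y)` with
`w(0) = 0`, `w(i) = i − 1` (`1 ≤ i ≤ q`), `w(q+1) = q − 1`, i.e. `w(i) = min (i − 1) (q − 1)`.  Then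
`a + b + c = 0` exactly on `Ψ_q = {x + y = z, x = 0 ∨ y = 0 ∨ z = q + 1}` and `= 1 > 0` on `Φ ∖ Ψ_q`
(`x, y ≥ 1`, `x + y ≤ q`): `Ψ_q ⊴ Φ` is a combinatorial degeneration in the sense of BCS Def. (15.29)(2).
[cite: BurgisserClausenShokrollahi1997, Def. (15.29)(2), Ex. (15.20)] -/
theorem isCombDegeneration_truncPoly_splitCw (q : ℕ) :
    IsCombDegeneration
      (Finset.univ.filter fun s : Fin (q + 2) × Fin (q + 2) × Fin (q + 2) =>
        (s.2.1 : ℕ) + (s.2.2 : ℕ) = (s.1 : ℕ))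
      (Finset.univ.filter fun s : Fin (q + 2) × Fin (q + 2) × Fin (q + 2) =>
        (s.2.1 : ℕ) + (s.2.2 : ℕ) = (s.1 : ℕ) ∧
          ((s.2.1 : ℕ) = 0 ∨ (s.2.2 : ℕ) = 0 ∨ (s.1 : ℕ) = q + 1)) := by
  refine ⟨fun s hs => ?_, fun z => ((min ((z : ℕ) - 1) (q - 1) : ℕ) : ℤ),
    fun x => -(((min ((x : ℕ) - 1) (q - 1) : ℕ) : ℤ)), fun y => -(((min ((y : ℕ) - 1) (q - 1) : ℕ) : ℤ)),
    ?_, ?_⟩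
  · simp only [Finset.mem_filter, Finset.mem_univ, true_and] at hs ⊢
    exact hs.1
  · rintro ⟨z, x, y⟩ hs
    simp only [Finset.mem_filter, Finset.mem_univ, true_and] at hs
    have hz := z.isLt
    have hx := x.isLt
    have hy := y.isLt
    simp only
    omega
  · rintro ⟨z, x, y⟩ hs hns
    simp only [Finset.mem_filter, Finset.mem_univ, true_and] at hs hns
    have hz := z.isLt
    have hx := x.isLt
    have hy := y.isLt
    simp only
    omega

end CombDeg

/-! ## 2. `Str(K[t]/(t^{q+2})) ⊵ L_q`, the split big Coppersmith–Winograd tensor (BCS Prop. (15.30)) -/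

section Degeneration

variable (K : Type u) [CommSemiring K]

/-- **Curvilinear domination (split form), every `q`, every commutative semiring.**  The structure tensor
`P_{q+2} = truncPolyMulTensor K (q+2)` of `K[t]/(t^{q+2})` (entry `1` at `(z,x,y)` with `x + y = z`)
degenerates — by the monomial substitution `t^z ↦ ε^{w(z)} t^z` on the output and `ε^{−w}` on the two inputs
of `isCombDegeneration_truncPoly_splitCw`, BCS Prop. (15.30) with the finest blocking — to the tensor `L_q`
keeping exactly the entries with `x = 0 ∨ y = 0 ∨ z = q + 1`: the structure tensor of the graded algebra
`K·1 ⊕ (K x_1 ⊕ ⋯ ⊕ K x_q) ⊕ K·s`, `x_i x_j = [i + j = q + 1]·s`, `x_i s = s² = 0` — the big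
Coppersmith–Winograd algebra with the SPLIT quadratic form `Σ_i x_i x_{q+1−i}` (support: `(0;0,0)`,
`(j;0,j)`, `(j;j,0)` for `1 ≤ j ≤ q+1`, `(q+1; i, q+1−i)` for `1 ≤ i ≤ q`; `3q + 3` points).
[cite: BurgisserClausenShokrollahi1997, Prop. (15.30), Ex. (15.20)] -/
theorem truncPolyMulTensor_polyDegeneratesTo_splitCw (q : ℕ) :
    PolyDegeneratesTo (truncPolyMulTensor K (q + 2))
      (fun z x y : Fin (q + 2) =>
        if (x : ℕ) + y = z ∧ ((x : ℕ) = 0 ∨ (y : ℕ) = 0 ∨ (z : ℕ) = q + 1) then (1 : K) else 0) := by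
  classical
  have hS : ∀ z x y : Fin (q + 2), truncPolyMulTensor K (q + 2) z x y ≠ 0 →
      (id z, id x, id y) ∈ (Finset.univ.filter fun s : Fin (q + 2) × Fin (q + 2) × Fin (q + 2) =>
        (s.2.1 : ℕ) + (s.2.2 : ℕ) = (s.1 : ℕ)) := by
    intro z x y hne
    simp only [id, Finset.mem_filter, Finset.mem_univ, true_and]
    by_contra hc
    exact hne (by rw [truncPolyMulTensor_apply, if_neg hc])
  have h := BCS1997_prop_15_30 (truncPolyMulTensor K (q + 2)) id id id _ _ hS
    (isCombDegeneration_truncPoly_splitCw q)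
  convert h using 1
  funext z x y
  rw [blockSubtensor_apply, truncPolyMulTensor_apply]
  simp only [id, Finset.mem_filter, Finset.mem_univ, true_and]
  by_cases h1 : (x : ℕ) + y = z
  · simp [h1]
  · simp [h1]

/-- The same for Kronecker powers: `P_{q+2}^{⊗N} ⊵ L_q^{⊗N}`. [cite: BurgisserClausenShokrollahi1997, Prop. (15.30), Lemma (15.24)] -/
theorem truncPolyMulTensor_kroneckerPow_polyDegeneratesTo_splitCw (q N : ℕ) :
    PolyDegeneratesTo (kroneckerPow (truncPolyMulTensor K (q + 2)) N)
      (kroneckerPow (fun z x y : Fin (q + 2) =>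
        if (x : ℕ) + y = z ∧ ((x : ℕ) = 0 ∨ (y : ℕ) = 0 ∨ (z : ℕ) = q + 1) then (1 : K) else 0) N) := by
  classical
  exact (truncPolyMulTensor_polyDegeneratesTo_splitCw K q).kroneckerPow N

end Degeneration

/-! ## 3. Asymptotic rank -/

section AsymptoticRank

variable (K : Type u) [Field K]

/-- Hence `R̃(L_q) ≤ R̃(P_{q+2})` over every field. [cite: BurgisserClausenShokrollahi1997, Prop. (15.30), (15.26)] -/
theorem asymptoticRank_splitCw_le_truncPolyMulTensor (q : ℕ) :
    asymptoticRank (fun z x y : Fin (q + 2) =>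
        if (x : ℕ) + y = z ∧ ((x : ℕ) = 0 ∨ (y : ℕ) = 0 ∨ (z : ℕ) = q + 1) then (1 : K) else 0) ≤
      asymptoticRank (truncPolyMulTensor K (q + 2)) :=
  asymptoticRank_le_of_polyDegeneratesTo (truncPolyMulTensor_polyDegeneratesTo_splitCw K q)

end AsymptoticRank

end Summit.MatrixMultiplication.MatrixMultiplication.Theorems.SaturationLadderCurvilinearDomination
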